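import Literature.MathematicalPhysics.QuantumFieldTheory.Balaban1983to89.B1TorusCubeDeriv
import Literature.MathematicalPhysics.QuantumFieldTheory.Balaban1983to89.B4Lemma22HolderBox
import Literature.MathematicalPhysics.QuantumFieldTheory.Balaban1983to89.B1Ineq234LevelZero

/-!
# `Balaban1983to89.B1TorusChainTransport` — CONTOURS `Γ`, «A(Γ) = Σ_{b⊂Γ} A_b» AND THE PARALLEL TRANSPORT `U(A(Γ))` OF
# [Balaban1983RegularityDecay] (1.4)/(1.9) ON THE (Higgs)₂,₃ TORUS OF [Balaban1982Higgs1]: nearest-neighbour chains, the pair form of a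
# vector field, `U(A(Γ)) = exp(qεe·A(Γ))`, chain geometry relative to the cubes `□_j` of §2, and «transport versus covariant derivative»
# `‖U(A(Γ))u(x′) − u(x)‖ ≤ ε·|Γ|·sup‖D^ε_Au‖` — the geometric layer of the HÖLDER CLAUSE (2.24)/(1.9) at a background field on `Ω = T_ε`

statement-level skeleton of published theorems with citation tags; proofs where landed; nothing here is a claim about the Yang–Mills mass gap

CITATION HEADER (lean-in-tree rule).  T. Bałaban, *Regularity and decay of lattice Green's functions*, Commun. Math. Phys. **89** (1983)
571–597 [Balaban1983RegularityDecay] (p. 572 «A(Γ) = Σ_{b⊂Γ} A_b», (1.4) `U(A(Γ_{y,x}))`, p. 573 Theorem (1.9) «Γ_{x,x′} a shortest contour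
connecting these points», p. 576 «A_{b̄} = −A_b», §2 p. 575 the cubes `□_j`, p. 578 the reduction to `|x′ − x| ≤ 1`) and T. Bałaban,
*(Higgs)₂,₃ quantum fields in a finite volume. I*, Commun. Math. Phys. **85** (1982) 603–626 [Balaban1982Higgs1] ((1.3) p. 604 the torus
distance, (1.7) p. 605 `U(A) = exp(qεeA)`, `D^ε_A`, Prop. 2.1 (2.24) p. 610 the Hölder clause with `U(A(Γ_{x,x′}))`).  Cell `lit-balaban`
(HOME `run/shared/lean/pub/lit-balaban/`), Phase-2 proof seat **p35** gen 10 (unit `lit-balaban-p35`); SKELETON rows **B4.Thm@573** ((1.9) on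
the torus), **B1.Prop2.1** ((2.24) at `A ≠ 0`).  USED BY NAME, never restated: the typer's `HiggsLattice.{Site, shift, unshift, tdist,
ChargeData.U, covDeriv}`, r02's `B2Restr216Lattice.norm_U_apply`, r14's `B1Ineq234LevelZero.{tdist_shift_le_one, tdist_comm, tdist_triangle_real}`,
r15's `B1Ineq234Concrete.tdist_self`, gen 8's `B1TorusCubeCover` (`Near`, `near_shift`, `near_unshift`, `near_mono`), the lineage's
`B4GaugeCovariance.pathEnd`, `B4Lemma22HolderBox.pathSum` (both generic in the site type).

WHAT IS PRINTED.  [B4] p. 572: *«For an arbitrary contour Γ in the lattice ηZ^d (considered as a sum of bonds) we define A(Γ) = Σ_{b⊂Γ} A_b,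
where orientations of the bonds b agree with orientation of the contour Γ.»*; p. 576: *«We assume also that A_{b̄} = −A_b for an arbitrary
bond b.»*; p. 573: *«for an arbitrary pair of points x, x′ ∈ ηZ^d, let us denote by Γ_{x,x′} a shortest contour connecting these points …
(1/|x − x′|^α)|U(A(Γ_{x,x′}))(D^η_{A,μ}G_k(Ω,A)f)(x′) − (D^η_{A,μ}G_k(Ω,A)f)(x)| ≤ c₀exp(−δ₀dist({x,x′}, supp f))‖f‖_∞ (1.9)»*; p. 578:
*«If |x′ − x| > 1, then this inequality is a simple consequence of the corresponding inequality for the derivative only»*.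
[B1] p. 604: *«|x − y| = max_μ min{|x_μ − y_μ|, 2L_μ − |x_μ − y_μ|} (1.3)»*; p. 605: *«U(A) = exp(qεeA) … (D^ε_Aφ)(b) = ε⁻¹(U(A_b)φ(b₊) − φ(b₋))»*.

WHAT THIS FILE PROVES (kernel-checked, zero `sorry`; four definitions with bodies + theorems; no `def … : Prop` fact; axioms standard).
* §1 CONTOURS ON THE TORUS: `TNbr` (lattice neighbours `y = x ± εe_μ`), `IsTChain x l` (a nearest-neighbour chain `x, l₀, l₁, …`), the
  PAIR FORM `bondVal A u v` of a vector field (`A_b` on `(b₋,b₊)`, `−A_b` on `(b₊,b₋)`, `0` otherwise: `bondVal_shift`, `bondVal_of_shift`,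
  valid when `|T|_μ > 2`), «A(Γ)» = the lineage's generic `pathSum (bondVal A) x l`, and **`hol C A x l = U(A(Γ)) = exp(qεe·A(Γ))`** with
  `hol_nil`, `hol_cons`/`hol_cons_apply` (the ordered product of the link variables), `norm_hol_apply` (isometry); `bondVal_congr`,
  `pathSum_bondVal_congr`, `hol_congr` (locality in `A`).
* §2 CHAIN GEOMETRY: `tdist_pathEnd_le`, `tdist_mem_chain_le` (a chain of length `n` stays within (1.3)-distance `n` of its start),
  `near_chain_fwd`/`near_chain_bwd` (a chain of length `n` starting or ending within `r` of `Mj` stays within `r + n`), and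
  **`norm_hol_apply_sub_le`**: `‖U(A(Γ))u(x′) − u(x)‖ ≤ ε·|Γ|·G` when `‖D^ε_Au‖ ≤ G` on the bonds of a set containing `Γ` (telescoping
  `U(A_b)u(b₊) − u(b₋) = ε·D^ε_Au(b)` bond by bond, `U` an isometry).
HONEST SCOPE: definitions and geometric lemmas only (no estimate of [B4] is proved here); abelian one-parameter links (1.7); the (1.9) contour
enters the consumer files as ANY nearest-neighbour chain of length `≤ d·|x − x′|` (covers every shortest contour).  Companion:
`B1TorusChainChart` (the same chains under the cube chart of §2).  Unit `lit-balaban-p35` gen 10 (literature-prover-lit-balaban-p35-g10-0).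
-/

open scoped BigOperators Matrix

noncomputable section

namespace Literature.MathematicalPhysics.QuantumFieldTheory.Balaban1983to89.B1TorusChainTransport

open Literature.MathematicalPhysics.QuantumFieldTheory.Balaban1983to89.HiggsLattice
open Literature.MathematicalPhysics.QuantumFieldTheory.Balaban1983to89.HiggsCovariancePos (shift_unshift unshift_shift)
open Literature.MathematicalPhysics.QuantumFieldTheory.Balaban1983to89.B4GaugeCovariance (pathEnd)
open Literature.MathematicalPhysics.QuantumFieldTheory.Balaban1983to89.B4Lemma22HolderBox (pathSum)
open Literature.MathematicalPhysics.QuantumFieldTheory.Balaban1983to89.B1TorusCubeCover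
open Literature.MathematicalPhysics.QuantumFieldTheory.Balaban1983to89.B2Restr216Lattice (norm_U_apply)
open Literature.MathematicalPhysics.QuantumFieldTheory.Balaban1983to89.B1Ineq234LevelZero (tdist_shift_le_one tdist_unshift_le_one
  tdist_comm tdist_triangle_real)
open Literature.MathematicalPhysics.QuantumFieldTheory.Balaban1983to89.B1Ineq234Concrete (tdist_self)

variable {P : HiggsLattice.Params} {N : ℕ}

/-! ## §1 Contours on the torus, «A(Γ) = Σ_{b⊂Γ} A_b», `U(A(Γ))` -/

section Chains

variable {k : ℕ}

/-- Lattice neighbours on the torus `T^{(k)}`: `y = x + εe_μ` or `x = y + εe_μ` (the bonds `⟨x,y⟩`, either orientation).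
[cite: Balaban1982Higgs1, (1.4) p.604] -/
def TNbr (x y : HiggsLattice.Site P k) : Prop := ∃ μ : Fin P.d, y = x.shift μ ∨ x = y.shift μ

/-- A CONTOUR «considered as a sum of bonds»: the chain `x, l₀, l₁, …, l_{n−1}` of sites, consecutive ones lattice neighbours (its end point
is the lineage's `pathEnd x l`, its length `l.length`). [cite: Balaban1983RegularityDecay, p.572 «an arbitrary contour Γ in the lattice»] -/
def IsTChain : HiggsLattice.Site P k → List (HiggsLattice.Site P k) → Prop
  | _, [] => True
  | x, y :: l => TNbr x y ∧ IsTChain y l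

/-- THE PAIR FORM OF A VECTOR FIELD: `A(u,v) = A_b` if `(u,v) = (b₋,b₊)`, `= −A_b` if `(u,v) = (b₊,b₋)` («A_{b̄} = −A_b»), `0` if `⟨u,v⟩` is
not a bond. [cite: Balaban1983RegularityDecay, p.572 «A(Γ) = Σ_{b⊂Γ} A_b», p.576 «A_{b̄} = −A_b»] -/
def bondVal (A : HiggsLattice.VecField P k) (u v : HiggsLattice.Site P k) : ℝ :=
  ∑ μ : Fin P.d, ((if v = u.shift μ then A ⟨u, μ⟩ else 0) - (if u = v.shift μ then A ⟨v, μ⟩ else 0))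

/-- **`U(A(Γ)) = exp(qεe·A(Γ))`**, `A(Γ) = Σ_{b⊂Γ} A_b` the lineage's `pathSum` of the pair form along the chain `Γ = (x, l)`.
[cite: Balaban1983RegularityDecay, (1.4) p.572, (1.9) p.573] [cite: Balaban1982Higgs1, (1.7) p.605] -/
def hol (C : ChargeData N) (A : HiggsLattice.VecField P k) (x : HiggsLattice.Site P k) (l : List (HiggsLattice.Site P k)) :
    EuclideanSpace ℝ (Fin N) →L[ℝ] EuclideanSpace ℝ (Fin N) :=
  C.U (P.mesh k) (pathSum (bondVal A) x l)

/-- The empty contour transports trivially: `U(A(∅)) = 1`. [cite: Balaban1983RegularityDecay, (1.4) p.572] -/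
theorem hol_nil (C : ChargeData N) (A : HiggsLattice.VecField P k) (x : HiggsLattice.Site P k) : hol C A x [] = 1 := by
  unfold hol; simp [pathSum, ChargeData.U_zero]

/-- `U(A(Γ))` is the ordered product of the link variables: `U(A(x, y :: l)) = U(A(x,y))·U(A(y, l))`.
[cite: Balaban1983RegularityDecay, (1.4) p.572] [cite: Balaban1982Higgs1, (1.7) p.605] -/
theorem hol_cons (C : ChargeData N) (A : HiggsLattice.VecField P k) (x y : HiggsLattice.Site P k) (l : List (HiggsLattice.Site P k)) :
    hol C A x (y :: l) = C.U (P.mesh k) (bondVal A x y) * hol C A y l := by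
  unfold hol; simp [pathSum, ChargeData.U_add]

/-- Applied form: `U(A(x, y :: l))v = U(A(x,y))(U(A(y,l))v)`. [cite: Balaban1983RegularityDecay, (1.4) p.572] -/
theorem hol_cons_apply (C : ChargeData N) (A : HiggsLattice.VecField P k) (x y : HiggsLattice.Site P k) (l : List (HiggsLattice.Site P k))
    (v : EuclideanSpace ℝ (Fin N)) : hol C A x (y :: l) v = C.U (P.mesh k) (bondVal A x y) (hol C A y l v) := by
  rw [hol_cons]; rfl

/-- `U(−a)U(a) = 1` applied: `U(−a)(U(a)w) = w`. [cite: Balaban1982Higgs1, (1.7) p.605 «U(A)* = U(−A) = U(−A)⁻¹»] -/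
theorem U_neg_U_apply (C : ChargeData N) (η a : ℝ) (w : EuclideanSpace ℝ (Fin N)) : C.U η (-a) (C.U η a w) = w := by
  change (C.U η (-a) * C.U η a) w = w
  rw [← ChargeData.U_add, neg_add_cancel, ChargeData.U_zero]; rfl

/-- `U(A(Γ))` is an isometry. [cite: Balaban1982Higgs1, (1.7) p.605] -/
theorem norm_hol_apply (C : ChargeData N) (A : HiggsLattice.VecField P k) (x : HiggsLattice.Site P k) (l : List (HiggsLattice.Site P k))
    (v : EuclideanSpace ℝ (Fin N)) : ‖hol C A x l v‖ = ‖v‖ :=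
  norm_U_apply C _ _ v

/-- `(x + εe_μ)_μ = x_μ + 1`. [cite: Balaban1982Higgs1, (1.2) p.604] -/
theorem shift_apply_self (x : HiggsLattice.Site P k) (μ : Fin P.d) : x.shift μ μ = x μ + 1 := by
  simp [HiggsLattice.Site.shift]

/-- `(x + εe_μ)_ν = x_ν` for `ν ≠ μ`. [cite: Balaban1982Higgs1, (1.2) p.604] -/
theorem shift_apply_ne (x : HiggsLattice.Site P k) {μ ν : Fin P.d} (h : ν ≠ μ) : x.shift μ ν = x ν := by
  simp [HiggsLattice.Site.shift, Function.update_of_ne h]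

/-- On a torus with more than two sites per direction distinct directions give distinct neighbours.
[cite: Balaban1982Higgs1, (1.2) p.604] -/
theorem shift_ne_shift (hS : ∀ μ, 2 < P.sitesPerDir k μ) (x : HiggsLattice.Site P k) {μ ν : Fin P.d} (h : μ ≠ ν) :
    x.shift μ ≠ x.shift ν := by
  intro e
  have e' := congrFun e ν
  rw [shift_apply_ne x (Ne.symm h), shift_apply_self] at e'
  have h1 : ((1 : ℕ) : ZMod (P.sitesPerDir k ν)) = 0 := by
    rw [Nat.cast_one]; exact add_eq_left.mp e'.symm
  rw [ZMod.natCast_eq_zero_iff] at h1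
  have := Nat.le_of_dvd one_pos h1
  have := hS ν
  omega

/-- … and no site is its own second neighbour: `(x + εe_μ) + εe_ν ≠ x`. [cite: Balaban1982Higgs1, (1.2) p.604] -/
theorem shift_shift_ne (hS : ∀ μ, 2 < P.sitesPerDir k μ) (x : HiggsLattice.Site P k) (μ ν : Fin P.d) :
    (x.shift μ).shift ν ≠ x := by
  intro e
  by_cases h : ν = μ
  · subst h
    have e' := congrFun e ν
    rw [shift_apply_self, shift_apply_self, add_assoc] at e'
    have h2 : ((2 : ℕ) : ZMod (P.sitesPerDir k ν)) = 0 := by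
      rw [show ((2 : ℕ) : ZMod (P.sitesPerDir k ν)) = 1 + 1 by norm_num]
      exact add_eq_left.mp e'
    rw [ZMod.natCast_eq_zero_iff] at h2
    have := Nat.le_of_dvd two_pos h2
    have := hS ν
    omega
  · have e' := congrFun e ν
    rw [shift_apply_self, shift_apply_ne x h] at e'
    have h1 : ((1 : ℕ) : ZMod (P.sitesPerDir k ν)) = 0 := by
      rw [Nat.cast_one]; exact add_eq_left.mp e'
    rw [ZMod.natCast_eq_zero_iff] at h1
    have := Nat.le_of_dvd one_pos h1
    have := hS ν
    omega

/-- **The pair form on a positively oriented bond**: `A(x, x + εe_μ) = A_{⟨x,μ⟩}`. [cite: Balaban1983RegularityDecay, p.572 «A(Γ) = Σ_{b⊂Γ} A_b»] -/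
theorem bondVal_shift (hS : ∀ μ, 2 < P.sitesPerDir k μ) (A : HiggsLattice.VecField P k) (x : HiggsLattice.Site P k) (μ : Fin P.d) :
    bondVal A x (x.shift μ) = A ⟨x, μ⟩ := by
  unfold bondVal
  rw [Finset.sum_eq_single μ]
  · rw [if_pos rfl, if_neg (shift_shift_ne hS x μ μ).symm, sub_zero]
  · intro ν _ hν
    rw [if_neg (shift_ne_shift hS x (Ne.symm hν)), if_neg (shift_shift_ne hS x μ ν).symm, sub_zero]
  · intro h; exact absurd (Finset.mem_univ μ) h

/-- **The pair form on a negatively oriented bond**: `A(y + εe_μ, y) = −A_{⟨y,μ⟩}` («A_{b̄} = −A_b»).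
[cite: Balaban1983RegularityDecay, p.576 «A_{b̄} = −A_b»] -/
theorem bondVal_of_shift (hS : ∀ μ, 2 < P.sitesPerDir k μ) (A : HiggsLattice.VecField P k) (y : HiggsLattice.Site P k) (μ : Fin P.d) :
    bondVal A (y.shift μ) y = -A ⟨y, μ⟩ := by
  unfold bondVal
  rw [Finset.sum_eq_single μ]
  · rw [if_neg (shift_shift_ne hS y μ μ).symm, if_pos rfl, zero_sub]
  · intro ν _ hν
    rw [if_neg (shift_shift_ne hS y μ ν).symm, if_neg (shift_ne_shift hS y (Ne.symm hν)), sub_zero]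
  · intro h; exact absurd (Finset.mem_univ μ) h

/-- LOCALITY OF THE PAIR FORM: `A(u,v)` depends on `A` only through the bonds starting at `u` or at `v`. [cite: Balaban1983RegularityDecay, p.572] -/
theorem bondVal_congr {A A' : HiggsLattice.VecField P k} {u v : HiggsLattice.Site P k}
    (hu : ∀ μ, A ⟨u, μ⟩ = A' ⟨u, μ⟩) (hv : ∀ μ, A ⟨v, μ⟩ = A' ⟨v, μ⟩) : bondVal A u v = bondVal A' u v := by
  unfold bondVal
  refine Finset.sum_congr rfl fun μ _ => ?_
  rw [hu μ, hv μ]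

/-- Hence `A(Γ) = A′(Γ)` when `A_b = A′_b` on every bond starting at a site of `Γ`. [cite: Balaban1983RegularityDecay, p.572] -/
theorem pathSum_bondVal_congr {A A' : HiggsLattice.VecField P k} {x : HiggsLattice.Site P k} {l : List (HiggsLattice.Site P k)}
    (h : ∀ y ∈ x :: l, ∀ μ, A ⟨y, μ⟩ = A' ⟨y, μ⟩) : pathSum (bondVal A) x l = pathSum (bondVal A') x l := by
  induction l generalizing x with
  | nil => simp [pathSum]
  | cons y l ih =>
      simp only [pathSum]
      rw [bondVal_congr (h x (by simp)) (h y (by simp)), ih (fun z hz μ => h z (by simp at hz ⊢; tauto) μ)]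

/-- … and `U(A(Γ)) = U(A′(Γ))` then. [cite: Balaban1983RegularityDecay, (1.4) p.572] -/
theorem hol_congr (C : ChargeData N) {A A' : HiggsLattice.VecField P k} {x : HiggsLattice.Site P k} {l : List (HiggsLattice.Site P k)}
    (h : ∀ y ∈ x :: l, ∀ μ, A ⟨y, μ⟩ = A' ⟨y, μ⟩) : hol C A x l = hol C A' x l := by
  unfold hol; rw [pathSum_bondVal_congr h]

end Chains

/-! ## §2 Chain geometry on the torus; transport versus covariant derivative -/

section Geometry

variable {k : ℕ}

/-- The end point of a chain of length `n` is within (1.3)-distance `n` of its start. [cite: Balaban1982Higgs1, (1.3) p.604] -/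
theorem tdist_pathEnd_le {x : HiggsLattice.Site P k} {l : List (HiggsLattice.Site P k)} (hl : IsTChain x l) :
    (HiggsLattice.Site.tdist x (pathEnd x l) : ℝ) ≤ l.length := by
  induction l generalizing x with
  | nil => simp [pathEnd, tdist_self]
  | cons y l ih =>
      obtain ⟨⟨μ, hμ⟩, hl'⟩ := hl
      simp only [pathEnd, List.length_cons, Nat.cast_succ]
      have h1 : (HiggsLattice.Site.tdist x y : ℝ) ≤ 1 := by
        rcases hμ with rfl | rfl
        · exact_mod_cast tdist_shift_le_one x μ
        · rw [tdist_comm]; exact_mod_cast tdist_shift_le_one y μ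
      have := tdist_triangle_real x y (pathEnd y l)
      have := ih hl'
      linarith

/-- Every site of a chain of length `n` is within (1.3)-distance `n` of its start. [cite: Balaban1982Higgs1, (1.3) p.604] -/
theorem tdist_mem_chain_le {x : HiggsLattice.Site P k} {l : List (HiggsLattice.Site P k)} (hl : IsTChain x l) :
    ∀ y ∈ x :: l, (HiggsLattice.Site.tdist x y : ℝ) ≤ l.length := by
  induction l generalizing x with
  | nil => intro y hy; simp at hy; subst hy; simp [tdist_self]
  | cons z l ih =>
      obtain ⟨⟨μ, hμ⟩, hl'⟩ := hl
      intro y hy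
      simp only [List.length_cons, Nat.cast_succ]
      rcases List.mem_cons.mp hy with rfl | hy'
      · rw [tdist_self]; push_cast; positivity
      · have h1 : (HiggsLattice.Site.tdist x z : ℝ) ≤ 1 := by
          rcases hμ with rfl | rfl
          · exact_mod_cast tdist_shift_le_one x μ
          · rw [tdist_comm]; exact_mod_cast tdist_shift_le_one z μ
        have := tdist_triangle_real x z y
        have := ih hl' y hy'
        linarith

variable {K K₀ : ℕ}

/-- A lattice neighbour of a site within `r` of `Mj` is within `r + 1`. [cite: Balaban1983RegularityDecay, §2 p.575] -/
theorem near_of_tNbr {r : ℕ} {j : Lab P K K₀} {x y : HiggsLattice.Site P 0} (hxy : TNbr x y) (hx : Near K K₀ r j x) :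
    Near K K₀ (r + 1) j y := by
  obtain ⟨μ, h | h⟩ := hxy
  · rw [h]; exact near_shift hx μ
  · rw [eq_unshift_of_shift_eq h.symm]; exact near_unshift hx μ

/-- `TNbr` is symmetric. [cite: Balaban1982Higgs1, (1.4) p.604] -/
theorem tNbr_symm {x y : HiggsLattice.Site P k} (h : TNbr x y) : TNbr y x := by
  obtain ⟨μ, h | h⟩ := h
  · exact ⟨μ, Or.inr h⟩
  · exact ⟨μ, Or.inl h⟩

/-- **A chain of length `n` STARTING within `r` of `Mj` stays within `r + n`.** [cite: Balaban1983RegularityDecay, §2 p.575] -/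
theorem near_chain_fwd {r : ℕ} {j : Lab P K K₀} {x : HiggsLattice.Site P 0} {l : List (HiggsLattice.Site P 0)} (hl : IsTChain x l)
    (hx : Near K K₀ r j x) : ∀ y ∈ x :: l, Near K K₀ (r + l.length) j y := by
  induction l generalizing x r with
  | nil => intro y hy; simp at hy; subst hy; simpa using hx
  | cons z l ih =>
      obtain ⟨hxz, hl'⟩ := hl
      intro y hy
      rcases List.mem_cons.mp hy with rfl | hy'
      · exact near_mono (by simp) hx
      · have h := ih hl' (near_of_tNbr hxz hx) y hy'
        simpa [Nat.add_assoc, Nat.add_comm 1] using h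

/-- **A chain of length `n` ENDING within `r` of `Mj` stays within `r + n`.** [cite: Balaban1983RegularityDecay, §2 p.575] -/
theorem near_chain_bwd {r : ℕ} {j : Lab P K K₀} {x : HiggsLattice.Site P 0} {l : List (HiggsLattice.Site P 0)} (hl : IsTChain x l)
    (hx : Near K K₀ r j (pathEnd x l)) : ∀ y ∈ x :: l, Near K K₀ (r + l.length) j y := by
  induction l generalizing x r with
  | nil => intro y hy; simp at hy; subst hy; simpa [pathEnd] using hx
  | cons z l ih =>
      obtain ⟨hxz, hl'⟩ := hl
      have hz : ∀ y ∈ z :: l, Near K K₀ (r + l.length) j y := ih hl' (by simpa [pathEnd] using hx)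
      intro y hy
      rcases List.mem_cons.mp hy with rfl | hy'
      · have h := near_of_tNbr (tNbr_symm hxz) (hz z (by simp))
        simpa [Nat.add_assoc] using h
      · exact near_mono (by simp) (hz y hy')

/-- `U(A_b)u(b₊) − u(b₋) = ε·(D^ε_Au)(b)`. [cite: Balaban1982Higgs1, (1.7) p.605] -/
theorem U_apply_sub_eq_smul_covDeriv (C : ChargeData N) (A : HiggsLattice.VecField P k) (u : HiggsLattice.ScalarField P k N)
    (b : HiggsLattice.PBond P k) : C.U (P.mesh k) (A b) (u b.tgt) - u b.src = P.mesh k • covDeriv C A u b := by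
  unfold covDeriv
  rw [smul_smul, mul_inv_cancel₀ (P.mesh_pos k).ne', one_smul]

/-- The reversed bond: `U(−A_b)u(b₋) − u(b₊) = −U(−A_b)(ε·D^ε_Au(b))`. [cite: Balaban1982Higgs1, (1.7) p.605 «U(A)* = U(−A)»] -/
theorem U_neg_apply_sub_eq (C : ChargeData N) (A : HiggsLattice.VecField P k) (u : HiggsLattice.ScalarField P k N)
    (b : HiggsLattice.PBond P k) :
    C.U (P.mesh k) (-A b) (u b.src) - u b.tgt = -(C.U (P.mesh k) (-A b) (P.mesh k • covDeriv C A u b)) := by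
  rw [← U_apply_sub_eq_smul_covDeriv, map_sub, U_neg_U_apply]
  abel

/-- **TRANSPORT VERSUS COVARIANT DERIVATIVE ALONG A CONTOUR**: if `‖D^ε_Au(b)‖ ≤ G` on every bond `b` with both ends in a set `Ω`
containing the chain `Γ = (x, l)`, then `‖U(A(Γ))u(x′) − u(x)‖ ≤ ε·|Γ|·G`, `x′` the end point (telescoping `U(A_b)u(b₊) − u(b₋) = εD^ε_Au(b)`
bond by bond; `U` is an isometry). [cite: Balaban1983RegularityDecay, (1.9) p.573, p.578 «If |x′ − x| > 1, then this inequality is a simple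
consequence of the corresponding inequality for the derivative only»] [cite: Balaban1982Higgs1, (1.7) p.605] -/
theorem norm_hol_apply_sub_le (hS : ∀ μ, 2 < P.sitesPerDir k μ) (C : ChargeData N) (A : HiggsLattice.VecField P k)
    (u : HiggsLattice.ScalarField P k N) (Ω : Finset (HiggsLattice.Site P k)) {G : ℝ}
    (hDu : ∀ (y : HiggsLattice.Site P k) (μ : Fin P.d), y ∈ Ω → y.shift μ ∈ Ω → ‖covDeriv C A u ⟨y, μ⟩‖ ≤ G)
    {x : HiggsLattice.Site P k} {l : List (HiggsLattice.Site P k)} (hl : IsTChain x l) (hΩ : ∀ y ∈ x :: l, y ∈ Ω) :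
    ‖hol C A x l (u (pathEnd x l)) - u x‖ ≤ P.mesh k * l.length * G := by
  induction l generalizing x with
  | nil => simp [hol_nil, pathEnd]
  | cons y l ih =>
      obtain ⟨⟨μ, hμ⟩, hl'⟩ := hl
      have hx : x ∈ Ω := hΩ x (by simp)
      have hy : y ∈ Ω := hΩ y (by simp)
      have hih := ih hl' (fun z hz => hΩ z (by simp at hz ⊢; tauto))
      have hε : 0 ≤ P.mesh k := (P.mesh_pos k).le
      simp only [pathEnd, List.length_cons, Nat.cast_succ, hol_cons_apply]
      -- `U_b(W u(x′)) − u(x) = U_b(W u(x′) − u(y)) + (U_b u(y) − u(x))`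
      have hsplit : C.U (P.mesh k) (bondVal A x y) (hol C A y l (u (pathEnd y l))) - u x
          = C.U (P.mesh k) (bondVal A x y) (hol C A y l (u (pathEnd y l)) - u y) + (C.U (P.mesh k) (bondVal A x y) (u y) - u x) := by
        rw [map_sub]; abel
      rw [hsplit]
      refine (norm_add_le _ _).trans ?_
      rw [norm_U_apply]
      have hstep : ‖C.U (P.mesh k) (bondVal A x y) (u y) - u x‖ ≤ P.mesh k * G := by
        rcases hμ with rfl | rfl
        · rw [bondVal_shift hS, show x.shift μ = (⟨x, μ⟩ : HiggsLattice.PBond P k).tgt from rfl,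
            show (x : HiggsLattice.Site P k) = (⟨x, μ⟩ : HiggsLattice.PBond P k).src from rfl, U_apply_sub_eq_smul_covDeriv,
            norm_smul, Real.norm_eq_abs, abs_of_nonneg hε]
          exact mul_le_mul_of_nonneg_left (hDu x μ hx hy) hε
        · rw [bondVal_of_shift hS, show y.shift μ = (⟨y, μ⟩ : HiggsLattice.PBond P k).tgt from rfl,
            show (y : HiggsLattice.Site P k) = (⟨y, μ⟩ : HiggsLattice.PBond P k).src from rfl, U_neg_apply_sub_eq, norm_neg,
            norm_U_apply, norm_smul, Real.norm_eq_abs, abs_of_nonneg hε]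
          exact mul_le_mul_of_nonneg_left (hDu y μ hy hx) hε
      calc ‖hol C A y l (u (pathEnd y l)) - u y‖ + ‖C.U (P.mesh k) (bondVal A x y) (u y) - u x‖
          ≤ P.mesh k * l.length * G + P.mesh k * G := add_le_add hih hstep
        _ = P.mesh k * (l.length + 1) * G := by ring

end Geometry

end Literature.MathematicalPhysics.QuantumFieldTheory.Balaban1983to89.B1TorusChainTransport
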